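import Summits.QuantumFields.BalabanUV.Beta.PeriodisedIndexLawSummable
import Summits.QuantumFields.BalabanUV.Beta.CombLamSectorLetters
import Summits.QuantumFields.BalabanUV.Beta.ValueJetGeneric
import Summits.QuantumFields.BalabanUV.Beta.SymmetrisedStepJetsParity
import Summits.QuantumFields.BalabanUV.Beta.StepReflectionRec
import Summits.QuantumFields.BalabanUV.Beta.CombChartWardSockets

/-!
# `BalabanUV.Beta.CombFormSlotPeriodised` — binder row D1 (OWNER an2), (J-a) dictionary item (α-2): **THE FORM SLOT OF THE CHART-(III′) LITERAL AT
# LEVEL `j+1 ≥ 1`, PERIODISED — ITS TORUS INDEX LAW ALONG A PURE GAUGE IS THE COMMUTATOR OF THE PERIODISED VALUE HESSIAN `E2 (j+1)` WITH THE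
# GAUGE FUNCTION, FACTOR `½`** (the level-`(j+1)` twin of leaf-05's level-0 `PeriodisedFormIndexWard.torus_H1_pureGauge_fun`; an exponentially localised
# family with a NON-ZERO contact, so the ℓ¹ exchange `PeriodisedIndexLawSummable.sum_tgrad_mul_perZ_dper_of_indexLaw_summable` is the engine — the finite-support
# §1 of `PeriodisedBorderIndexWard` does not apply)

WHAT.  `T_{j+1} κ u := e3OfK Lc (GcombSh Lc j) (JsB12CombSh0 hLc N (symTablesAn1S2 3 Lc cΛ) cΛ cB j).S κ u` is the FORM SLOT of the literal of record at
level `j+1` (its `Lc⁴·wE (j+1)`-weighted member, `CombFormSlotGaugeLetter.JsB12CombSh0_S_succ`).  Its PER-SITE gauge letter is an2 g39's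
`CombFormSlotGaugeLetter.divV_formSlot_JsB12CombSh0_an1TablesS2_inl_inl`: `(divV T_{j+1} u) x z (inl a) (inl b) = ½·E2 3 Lc (j+1) x z (inl a) (inl b)·([z = u] − [x = u])`
— an index-slot law with CONTACT `q := −½ • E2 3 Lc (j+1)` at the contact point `p₁ := id`.  With (α-loc) `locStencil_formSlot_an1TablesS2` (an2 g33's
`ValueJetGeneric.locStencil_e3OfK` fed `decays_GcombSh` and the member's `JetData.loc`) and (α-t) `formSlot_an1TablesS2_translate` (`e3OfK_translate` fed
`shiftK_GcombSh` + `JsB12CombSh0_S_translate`: UNIT-translation covariance on the level-`(j+1)` lattice) the ℓ¹ §1 of `CombLamSectorPeriodised` gives, on ANY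
period box `F`:
* **`sum_tgrad_mul_perZ_dper_formSlot`**: `Σ_{u ∈ pbox F} Σ_κ tgrad F (u, inl κ) s · perZ F (dper F (T_{j+1} κ u)) x z (inl α) (inl β)
  = −½·(tdelta F x s − tdelta F z s)·perZ F (E2 3 Lc (j+1)) x z (inl α) (inl β)`;
* **`torus_formSlot_indexLaw`** (matrix form, any weight `w`, any torus gauge function `λ`): with `Φ b := w • (perF F (dper F (T_{j+1} b.2 ↑b.1)))∘(ff)` and
  `P := (perF F (E2 3 Lc (j+1)))∘(ff)`, `Σ_b (Σ_s tgrad F (b.1, inl b.2) s · λ s) • Φ b = (w∕2) • (P·E_λ − E_λ·P)`, `E_λ := diagonal (λ ∘ Prod.fst)`;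
* **`torus_formSlot_indexLaw_bhKStepAt`** — the same in the (β) door's `H₀` currency: `(perF F (bhKStepAt 3 ρ Lc (j+1)))∘(ff) = wVH 3 Lc (j+1) • P`
  (`BorderedHessianStep.bhKStepAt_succ_inl_inl`, any root `ρ`; `perF_bhKStepAt_succ_ff`), hence
  `Σ_b (Dλ)_b • Φ b = (w ∕ (2·wVH 3 Lc (j+1))) • (H₀^{ff}·E_λ − E_λ·H₀^{ff})` — the SIMILARITY shape of leaf-05's `torus_k1_sim_letter` one level up: with the
  road's generator pin `X = −c_{j+1}•E_λ` the door's `k1` holds for the form family EXACTLY at the weight `w = −2·c_{j+1}·wVH 3 Lc (j+1)` (the road's to match;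
  cf. `CombFormSlotGaugeLetter.formWeight_eq`).

* §4 PARITY (the door's `hH₁t`, form half): `trK_JsB12CombSh0_S_an1TablesS2` (every member row-parity-odd at the record — `SymmetrisedStepJetsParity.trK_SrecOf`
  fed the comb letters), `trK_formSlot_an1TablesS2` ((α-p): `SpineRecursiveParity.trK_e3OfK_of_rows`), `trF_formSlot_an1TablesS2` (ff-supported ⇒ `trF T = −T`),
  `perF_dper_formSlot_an1TablesS2_transpose`, **`torus_formSlot_family_transpose`** (`(Φ b)ᵀ = −Φ b`, any weight, any box).

[folklore] bookkeeping over OUR typed objects BY NAME; no `def`, no `def … : Prop`, nothing cited, 0 sorry.  WHAT THIS DOES NOT SAY: the (β-b′) door's `k1` at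
level `j+1` itself (the road binds `H₁`, the weight and `X`; this file supplies the periodised contact law its form half needs), the Λ half (`CombLamSectorPeriodised`),
the border∕composite rows, anything at order 2.  0 estimates beyond the [folklore] summabilities; 0∕4 row-D1 binders; `D1Tel` ∕ `D1Rep` OPEN; NOT (T-ID), NOT
(J-a) complete, NOT D1, NEVER «G-an2-4 closed», NOT BetaPertH, NOT continuum, NOT Clay.

HONEST DEPENDENCY (page 1, mandatory): continuum YM on T⁴ ⇐ BetaPertH ∧ nine spine estimates (0/9 proved); BetaPertH ⇐ (D1) ∧ (D4) ∧ CAP+tail;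
G-an2-4 gates asym, D1 and NE2/3/4.  HONEST FRAMING (cell contract, verbatim): «discharging `BetaPertH` makes Bałaban's UV stability UNCONDITIONAL —
a real constructive-QFT result; it is NOT the continuum limit and NOT the Clay problem.»  ABSOLUTE RULE (cell charter, verbatim): «No internally-minted
statement may enter as a cited fact. Every hypothesis is either kernel-proved in this package or a verbatim quotation of a PUBLISHED theorem with page
reference. The manuscript(s) under audit are NOT citable for their own disputed steps — they are the thing under adjudication; programme-internal
(2001/route/tribunal) claims are never citable.»  Row D1 OWNER an2 (b2b-balaban-beta-an2) gen 41, 2026-08-22.  No existing file touched.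
-/

noncomputable section

open scoped BigOperators Matrix
open Finset

namespace Summit.QuantumFields.BalabanUV.Beta.CombFormSlotPeriodised

open Literature.MathematicalPhysics.QuantumFieldTheory
open Literature.MathematicalPhysics.QuantumFieldTheory.Balaban1983to89
open Literature.MathematicalPhysics.QuantumFieldTheory.Balaban1983to89.Beta
open B4TorusKernel.MultiPeriod (translate)
open B6Lemma24Torus (pbox)
open ExpKernelCalculus (MKer shiftK)
open AffineAveraging (Site unitVec)
open KernelWard (divV)
open OneStepResolventKernel (Fib LocStencil)
open BalabanStepJetsSucc (wVH E2)
open Summit.QuantumFields.BalabanUV.Beta.BorderedHessian (bhKStepAt bhKStepAt_succ_inl_inl)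
open Summit.QuantumFields.BalabanUV.Beta.WardLocusStencils (divV_apply)
open Summit.QuantumFields.BalabanUV.Beta.TameKernelCalculus (trK trK_apply)
open Summit.QuantumFields.BalabanUV.Beta.BorderedHessian (sgnK sgnF_inl)
open Summit.QuantumFields.BalabanUV.Beta.SpineRooted (e3OfK locStencil_e3OfK e3OfK_translate e3OfK_inl_inr e3OfK_inr_inl e3OfK_inr_inr)
open Summit.QuantumFields.BalabanUV.Beta.SpineRecursiveParity (trK_e3OfK_of_rows)
open Summit.QuantumFields.BalabanUV.Beta.CombChartStepJets (GcombSh decays_GcombSh shiftK_GcombSh JsB12CombSh0 JsB12CombSh0_S_translate JsB12CombSh0_eq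
  JsComb0Of_S ScombOf_eq)
open Summit.QuantumFields.BalabanUV.Beta.CombChartContactFactor (spr_GcombSh)
open Summit.QuantumFields.BalabanUV.Beta.CombChartWardSockets (trK_GcombSh)
open Summit.QuantumFields.BalabanUV.Beta.SymmetrisedStepJetsParity (trK_SrecOf)
open Summit.QuantumFields.BalabanUV.Beta.SymAveragingHessianCounts (symVhSAt_hV_ctr symHessFFAt_hH_ctr)
open Summit.QuantumFields.BalabanUV.Beta.SymTablesAn1FirstOrder (trK_symVhSAt trK_symHessFFAt)
open Summit.QuantumFields.BalabanUV.Beta.SymSecondOrderTablesAn1 (symTablesAn1S2)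
open Summit.QuantumFields.BalabanUV.Beta.CombFormSlotGaugeLetter (divV_formSlot_JsB12CombSh0_an1TablesS2_inl_inl)
open Summit.QuantumFields.BalabanUV.Beta.FP.KernelPeriodisationFib (Idx perF perF_apply perZ perZ_apply perZ_smul trF)
open Summit.QuantumFields.BalabanUV.Beta.FP.KernelPeriodisationFibLoc (dper)
open Summit.QuantumFields.BalabanUV.Beta.FP.TorusGaugeCovariance (tdelta tgrad)
open Summit.QuantumFields.BalabanUV.Beta.FP.TorusGaugeCovariancePairing (sum_tdelta_mul wrapPt_of_mem)
open Summit.QuantumFields.BalabanUV.Beta.PeriodisedIndexLawSummable (sum_tgrad_mul_perZ_dper_of_indexLaw_summable perF_dper_transpose_of_trF)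

variable {Lc : ℕ} [NeZero Lc]

/-! ## §1 The form slot of record at level `j+1`: localisation, covariance, the index law with contact -/

/-- [folklore] **(α-loc) THE FORM SLOT OF RECORD IS A LOCAL STENCIL FAMILY** at every level (`ValueJetGeneric.locStencil_e3OfK` fed `decays_GcombSh Lc j` and
the member's own `JetData.loc ∕ δ_pos`; the constant read off non-negative). -/
theorem locStencil_formSlot_an1TablesS2 (hLc : Odd Lc) (N : ℕ) (cΛ cB : ℝ) (j : ℕ) :
    ∃ C δ : ℝ, 0 ≤ C ∧ 0 < δ ∧
      LocStencil (e3OfK Lc (GcombSh (d := 3) Lc j) (JsB12CombSh0 hLc N (symTablesAn1S2 3 Lc cΛ) cΛ cB j).S) C δ := by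
  have hLc1 : 1 ≤ Lc := Nat.one_le_iff_ne_zero.2 (NeZero.ne Lc)
  obtain ⟨C, δ, hδ, h⟩ := locStencil_e3OfK (d := 3) hLc1 (decays_GcombSh (d := 3) Lc j)
    (JsB12CombSh0 hLc N (symTablesAn1S2 3 Lc cΛ) cΛ cB j).loc (JsB12CombSh0 hLc N (symTablesAn1S2 3 Lc cΛ) cΛ cB j).δ_pos
  refine ⟨C, δ, ?_, hδ, h⟩
  have h0 := h 0 0 0 0 (Sum.inl 0) (Sum.inl 0)
  exact (mul_nonneg_iff_of_pos_right (Real.exp_pos _)).1 ((abs_nonneg _).trans h0)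

/-- [folklore] **(α-t) THE FORM SLOT OF RECORD IS TRANSLATION COVARIANT UNDER UNIT TRANSLATIONS** of the level-`(j+1)` lattice (`e3OfK_translate` fed
`shiftK_GcombSh` and `JsB12CombSh0_S_translate`), written at blocking scale `1` for the ℓ¹ §1. -/
theorem formSlot_an1TablesS2_translate (hLc : Odd Lc) (N : ℕ) (cΛ cB : ℝ) (j : ℕ) (κ : Fin 4) (u t : Site 4) :
    e3OfK Lc (GcombSh (d := 3) Lc j) (JsB12CombSh0 hLc N (symTablesAn1S2 3 Lc cΛ) cΛ cB j).S κ (u + (((1 : ℕ) : ℕ) : ℤ) • t)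
      = shiftK (-((((1 : ℕ) : ℕ) : ℤ) • t)) (e3OfK Lc (GcombSh (d := 3) Lc j) (JsB12CombSh0 hLc N (symTablesAn1S2 3 Lc cΛ) cΛ cB j).S κ u) := by
  rw [Nat.cast_one, one_smul]
  exact e3OfK_translate (shiftK_GcombSh (d := 3) (Lc := Lc) j) (JsB12CombSh0_S_translate hLc N (symTablesAn1S2 3 Lc cΛ) cΛ cB j) κ u t

/-- [folklore] **(α-g) THE INDEX-SLOT LAW OF THE FORM SLOT IN `Σ`-FORM, FIELD–FIELD BLOCK, WITH ITS CONTACT** (`CombFormSlotGaugeLetter` §3 with an1's `divV`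
unfolded and the two unit-vector conventions bridged): `Σ_κ (T κ (w − e_κ) − T κ w) x z (inl α) (inl β) = ([x = w] − [z = w]) · (−½ • E2 3 Lc (j+1)) x z (inl α) (inl β)`. -/
theorem formSlot_an1TablesS2_indexLaw_inl_inl (hLc : Odd Lc) (N : ℕ) (cΛ cB : ℝ) (j : ℕ) (w x z : Site 4) (α β : Fin 4) :
    ∑ κ : Fin 4, (e3OfK Lc (GcombSh (d := 3) Lc j) (JsB12CombSh0 hLc N (symTablesAn1S2 3 Lc cΛ) cΛ cB j).S κ (w - unitVec κ) x z (Sum.inl α) (Sum.inl β)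
        - e3OfK Lc (GcombSh (d := 3) Lc j) (JsB12CombSh0 hLc N (symTablesAn1S2 3 Lc cΛ) cΛ cB j).S κ w x z (Sum.inl α) (Sum.inl β))
      = ((if id x = w then (1 : ℝ) else 0) - (if z = w then 1 else 0)) * ((-(1 / 2 : ℝ)) • E2 3 Lc (j + 1)) x z (Sum.inl α) (Sum.inl β) := by
  have hu : ∀ κ : Fin 4, (B6BondElimination.unitVec κ : Site 4) = unitVec κ := fun κ => by
    funext i
    simp only [B6BondElimination.unitVec, AffineAveraging.unitVec, Pi.single_apply]
  have h := divV_formSlot_JsB12CombSh0_an1TablesS2_inl_inl hLc N cΛ cB j w x z α β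
  rw [divV_apply] at h
  simp only [hu] at h
  rw [h, Pi.smul_apply, Pi.smul_apply, Pi.smul_apply, Pi.smul_apply, smul_eq_mul, id]
  ring

/-! ## §2 The torus index law of the periodised form slot, any period box -/

variable {F : Fin 4 → ℕ} [∀ μ, NeZero (F μ)]

/-- [folklore] **`sum_tgrad_mul_perZ_dper_formSlot` — THE FORM SLOT OF RECORD INSERTED ALONG A TORUS PURE GAUGE, FIELD–FIELD ENTRY** (any period box `F`):
`Σ_{u ∈ pbox F} Σ_κ tgrad F (u, inl κ) s · perZ F (dper F (T_{j+1} κ u)) x z (inl α) (inl β) = −½·(tdelta F x s − tdelta F z s)·perZ F (E2 3 Lc (j+1)) x z (inl α) (inl β)`. -/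
theorem sum_tgrad_mul_perZ_dper_formSlot (hLc : Odd Lc) (N : ℕ) (cΛ cB : ℝ) (j : ℕ) (s : ↥(pbox F)) (x z : Site 4) (α β : Fin 4) :
    ∑ u : ↥(pbox F), ∑ κ : Fin 4, tgrad F (u, Sum.inl κ) s *
        perZ F (dper F (e3OfK Lc (GcombSh (d := 3) Lc j) (JsB12CombSh0 hLc N (symTablesAn1S2 3 Lc cΛ) cΛ cB j).S κ (u : Site 4))) x z (Sum.inl α) (Sum.inl β)
      = -(1 / 2 : ℝ) * ((tdelta F x s - tdelta F z s) * perZ F (E2 3 Lc (j + 1)) x z (Sum.inl α) (Sum.inl β)) := by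
  obtain ⟨C, δ, hC, hδ, hV⟩ := locStencil_formSlot_an1TablesS2 hLc N cΛ cB j
  rw [sum_tgrad_mul_perZ_dper_of_indexLaw_summable (M := F) (M' := F) (N := 1) _ ((-(1 / 2 : ℝ)) • E2 3 Lc (j + 1)) id (Sum.inl α) (Sum.inl β)
      (fun i => (one_mul _).symm) (formSlot_an1TablesS2_translate hLc N cΛ cB j) hV hC hδ
      (fun w x z => formSlot_an1TablesS2_indexLaw_inl_inl hLc N cΛ cB j w x z α β) s x z,
    perZ_smul]
  simp only [Pi.smul_apply, smul_eq_mul, id]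
  ring

/-- [folklore] **`torus_formSlot_indexLaw` — THE TORUS INDEX LAW OF THE PERIODISED FORM SLOT, MATRIX FORM** (any period box `F`, any weight `w`, any torus
gauge function `λ`): with `Φ b := w • (perF F (dper F (T_{j+1} b.2 ↑b.1)))∘(ff)` and `P := (perF F (E2 3 Lc (j+1)))∘(ff)`,
`Σ_b (Σ_s tgrad F (b.1, inl b.2) s · λ s) • Φ b = (w∕2) • (P·E_λ − E_λ·P)`, `E_λ = diagonal (λ ∘ Prod.fst)`. -/
theorem torus_formSlot_indexLaw (hLc : Odd Lc) (N : ℕ) (cΛ cB : ℝ) (j : ℕ) (w : ℝ) (lam : ↥(pbox F) → ℝ) :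
    ∑ b : ↥(pbox F) × Fin 4, (∑ s : ↥(pbox F), tgrad F (b.1, Sum.inl b.2) s * lam s) •
        (w • (perF F (dper F (e3OfK Lc (GcombSh (d := 3) Lc j) (JsB12CombSh0 hLc N (symTablesAn1S2 3 Lc cΛ) cΛ cB j).S b.2 (b.1 : Site 4)))).submatrix
          (fun b : ↥(pbox F) × Fin 4 => ((b.1, Sum.inl b.2) : Idx F (Fib 3)))
          (fun b : ↥(pbox F) × Fin 4 => ((b.1, Sum.inl b.2) : Idx F (Fib 3))))
      = (w / 2) • ((perF F (E2 3 Lc (j + 1))).submatrix (fun b : ↥(pbox F) × Fin 4 => ((b.1, Sum.inl b.2) : Idx F (Fib 3)))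
              (fun b : ↥(pbox F) × Fin 4 => ((b.1, Sum.inl b.2) : Idx F (Fib 3))) * Matrix.diagonal (fun b : ↥(pbox F) × Fin 4 => lam b.1)
          - Matrix.diagonal (fun b : ↥(pbox F) × Fin 4 => lam b.1) * (perF F (E2 3 Lc (j + 1))).submatrix
              (fun b : ↥(pbox F) × Fin 4 => ((b.1, Sum.inl b.2) : Idx F (Fib 3))) (fun b : ↥(pbox F) × Fin 4 => ((b.1, Sum.inl b.2) : Idx F (Fib 3)))) := by
  ext p q'
  simp only [Matrix.sum_apply, Matrix.smul_apply, Matrix.submatrix_apply, perF_apply, smul_eq_mul, Matrix.sub_apply, Matrix.mul_diagonal,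
    Matrix.diagonal_mul]
  rw [Fintype.sum_prod_type]
  have hre : ∀ u : ↥(pbox F), ∑ κ : Fin 4, (∑ s : ↥(pbox F), tgrad F (u, Sum.inl κ) s * lam s)
        * (w * perZ F (dper F (e3OfK Lc (GcombSh (d := 3) Lc j) (JsB12CombSh0 hLc N (symTablesAn1S2 3 Lc cΛ) cΛ cB j).S κ (u : Site 4)))
          (p.1 : Site 4) (q'.1 : Site 4) (Sum.inl p.2) (Sum.inl q'.2))
      = ∑ s : ↥(pbox F), ∑ κ : Fin 4, (lam s * w) * (tgrad F (u, Sum.inl κ) s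
        * perZ F (dper F (e3OfK Lc (GcombSh (d := 3) Lc j) (JsB12CombSh0 hLc N (symTablesAn1S2 3 Lc cΛ) cΛ cB j).S κ (u : Site 4)))
          (p.1 : Site 4) (q'.1 : Site 4) (Sum.inl p.2) (Sum.inl q'.2)) := fun u => by
    simp only [Finset.sum_mul]
    rw [Finset.sum_comm]
    exact Finset.sum_congr rfl fun s _ => Finset.sum_congr rfl fun κ _ => by ring
  rw [Finset.sum_congr rfl fun u _ => hre u, Finset.sum_comm]
  have hs : ∀ s : ↥(pbox F), ∑ u : ↥(pbox F), ∑ κ : Fin 4, (lam s * w) * (tgrad F (u, Sum.inl κ) s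
        * perZ F (dper F (e3OfK Lc (GcombSh (d := 3) Lc j) (JsB12CombSh0 hLc N (symTablesAn1S2 3 Lc cΛ) cΛ cB j).S κ (u : Site 4)))
          (p.1 : Site 4) (q'.1 : Site 4) (Sum.inl p.2) (Sum.inl q'.2))
      = (-(w / 2) * perZ F (E2 3 Lc (j + 1)) (p.1 : Site 4) (q'.1 : Site 4) (Sum.inl p.2) (Sum.inl q'.2)) * (tdelta F (p.1 : Site 4) s * lam s)
        - (-(w / 2) * perZ F (E2 3 Lc (j + 1)) (p.1 : Site 4) (q'.1 : Site 4) (Sum.inl p.2) (Sum.inl q'.2)) * (tdelta F (q'.1 : Site 4) s * lam s) := fun s => by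
    rw [Finset.sum_congr rfl fun u _ => (Finset.mul_sum _ _ _).symm, ← Finset.mul_sum,
      sum_tgrad_mul_perZ_dper_formSlot hLc N cΛ cB j s _ _ p.2 q'.2]
    ring
  rw [Finset.sum_congr rfl fun s _ => hs s, Finset.sum_sub_distrib, ← Finset.mul_sum, ← Finset.mul_sum, sum_tdelta_mul, sum_tdelta_mul,
    wrapPt_of_mem, wrapPt_of_mem]
  ring

/-! ## §3 In the (β) door's `H₀` currency: the periodised field block of the level-`(j+1)` candidate is `wVH (j+1) •` the periodised value Hessian -/

omit [∀ μ, NeZero (F μ)] in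
/-- [folklore] **THE FIELD–FIELD BLOCK OF THE PERIODISED LEVEL-`(j+1)` CANDIDATE IS `wVH 3 Lc (j+1) •` THE PERIODISED VALUE HESSIAN** (any root `ρ`, any box `F`;
`bhKStepAt_succ_inl_inl` under the period sum — no summability). -/
theorem perF_bhKStepAt_succ_ff (ρ : Site 4) (j : ℕ) :
    (perF F (bhKStepAt 3 ρ Lc (j + 1))).submatrix (fun b : ↥(pbox F) × Fin 4 => ((b.1, Sum.inl b.2) : Idx F (Fib 3)))
        (fun b : ↥(pbox F) × Fin 4 => ((b.1, Sum.inl b.2) : Idx F (Fib 3)))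
      = wVH 3 Lc (j + 1) • (perF F (E2 3 Lc (j + 1))).submatrix (fun b : ↥(pbox F) × Fin 4 => ((b.1, Sum.inl b.2) : Idx F (Fib 3)))
        (fun b : ↥(pbox F) × Fin 4 => ((b.1, Sum.inl b.2) : Idx F (Fib 3))) := by
  ext p q'
  simp only [Matrix.submatrix_apply, perF_apply, perZ_apply, Matrix.smul_apply, smul_eq_mul, bhKStepAt_succ_inl_inl, tsum_mul_left]

/-- [folklore] **`torus_formSlot_indexLaw_bhKStepAt` — THE TORUS INDEX LAW OF THE PERIODISED FORM SLOT IN THE DOOR's `H₀` CURRENCY** (any root `ρ`, box `F`,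
weight `w`, gauge function `λ`): with `H₀^{ff} := (perF F (bhKStepAt 3 ρ Lc (j+1)))∘(ff)`,
`Σ_b (Σ_s tgrad F (b.1, inl b.2) s · λ s) • Φ b = (w ∕ (2·wVH 3 Lc (j+1))) • (H₀^{ff}·E_λ − E_λ·H₀^{ff})` — the similarity shape of leaf-05's level-0
`torus_k1_sim_letter`, one level up: against the road's pin `X = −c•E_λ` the door's `k1` holds for the form family exactly at `w = −2·c·wVH 3 Lc (j+1)`. -/
theorem torus_formSlot_indexLaw_bhKStepAt (hLc : Odd Lc) (N : ℕ) (cΛ cB : ℝ) (j : ℕ) (ρ : Site 4) (w : ℝ) (lam : ↥(pbox F) → ℝ) :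
    ∑ b : ↥(pbox F) × Fin 4, (∑ s : ↥(pbox F), tgrad F (b.1, Sum.inl b.2) s * lam s) •
        (w • (perF F (dper F (e3OfK Lc (GcombSh (d := 3) Lc j) (JsB12CombSh0 hLc N (symTablesAn1S2 3 Lc cΛ) cΛ cB j).S b.2 (b.1 : Site 4)))).submatrix
          (fun b : ↥(pbox F) × Fin 4 => ((b.1, Sum.inl b.2) : Idx F (Fib 3)))
          (fun b : ↥(pbox F) × Fin 4 => ((b.1, Sum.inl b.2) : Idx F (Fib 3))))
      = (w / (2 * wVH 3 Lc (j + 1))) •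
          ((perF F (bhKStepAt 3 ρ Lc (j + 1))).submatrix (fun b : ↥(pbox F) × Fin 4 => ((b.1, Sum.inl b.2) : Idx F (Fib 3)))
              (fun b : ↥(pbox F) × Fin 4 => ((b.1, Sum.inl b.2) : Idx F (Fib 3))) * Matrix.diagonal (fun b : ↥(pbox F) × Fin 4 => lam b.1)
          - Matrix.diagonal (fun b : ↥(pbox F) × Fin 4 => lam b.1) * (perF F (bhKStepAt 3 ρ Lc (j + 1))).submatrix
              (fun b : ↥(pbox F) × Fin 4 => ((b.1, Sum.inl b.2) : Idx F (Fib 3))) (fun b : ↥(pbox F) × Fin 4 => ((b.1, Sum.inl b.2) : Idx F (Fib 3)))) := by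
  have hw : wVH 3 Lc (j + 1) ≠ 0 := by
    have hL : (0 : ℝ) < Lc := by exact_mod_cast Nat.pos_of_ne_zero (NeZero.ne Lc)
    unfold wVH
    positivity
  rw [torus_formSlot_indexLaw hLc N cΛ cB j w lam, perF_bhKStepAt_succ_ff, Matrix.smul_mul, Matrix.mul_smul, ← smul_sub, smul_smul]
  congr 1
  field_simp

/-! ## §4 Parity: the form slot of record is fibre-transpose-odd, so each periodised member is an antisymmetric matrix (the door's `hH₁t`, form half) -/

/-- [folklore] **THE LITERAL's FIRST-ORDER MEMBERS ARE ROW-PARITY-ODD AT EVERY LEVEL, AT THE RECORD** (`SymmetrisedStepJetsParity.trK_SrecOf` fed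
`decays_GcombSh`, `trK_GcombSh`, an1's `trK_symVhSAt ∕ trK_symHessFFAt` and (LV)(LH) at the centred root). -/
theorem trK_JsB12CombSh0_S_an1TablesS2 (hLc : Odd Lc) (N : ℕ) (cΛ cB : ℝ) (j : ℕ) (κ : Fin 4) (u : Site 4) :
    trK ((JsB12CombSh0 hLc N (symTablesAn1S2 3 Lc cΛ) cΛ cB j).S κ u) = -sgnK ((JsB12CombSh0 hLc N (symTablesAn1S2 3 Lc cΛ) cΛ cB j).S κ u) := by
  have hLc1 : 1 ≤ Lc := Nat.one_le_iff_ne_zero.2 (NeZero.ne Lc)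
  rw [JsB12CombSh0_eq, JsComb0Of_S, ScombOf_eq]
  exact trK_SrecOf (d := 3) (symVhSAt_hV_ctr (d := 3) hLc1) (symHessFFAt_hH_ctr (d := 3) hLc1) (decays_GcombSh Lc)
    (fun j' => trK_GcombSh (d := 3) (Lc := Lc) j') (fun κ u => trK_symVhSAt _ _ κ u) (fun μ y => trK_symHessFFAt _ _ μ y) _ _ cΛ j κ u

/-- [folklore] **(α-p) THE FORM SLOT OF RECORD IS ROW-PARITY-ODD** (`SpineRecursiveParity.trK_e3OfK_of_rows` fed `spr_GcombSh`, `trK_GcombSh`, the member's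
`JetData.loc ∕ δ_pos` and `trK_JsB12CombSh0_S_an1TablesS2`). -/
theorem trK_formSlot_an1TablesS2 (hLc : Odd Lc) (N : ℕ) (cΛ cB : ℝ) (j : ℕ) (κ : Fin 4) (u : Site 4) :
    trK (e3OfK Lc (GcombSh (d := 3) Lc j) (JsB12CombSh0 hLc N (symTablesAn1S2 3 Lc cΛ) cΛ cB j).S κ u)
      = -sgnK (e3OfK Lc (GcombSh (d := 3) Lc j) (JsB12CombSh0 hLc N (symTablesAn1S2 3 Lc cΛ) cΛ cB j).S κ u) :=
  trK_e3OfK_of_rows (spr_GcombSh (d := 3) (Lc := Lc) j) (trK_GcombSh (d := 3) (Lc := Lc) j)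
    (JsB12CombSh0 hLc N (symTablesAn1S2 3 Lc cΛ) cΛ cB j).loc (JsB12CombSh0 hLc N (symTablesAn1S2 3 Lc cΛ) cΛ cB j).δ_pos
    (fun κ u => trK_JsB12CombSh0_S_an1TablesS2 hLc N cΛ cB j κ u) κ u

/-- [folklore] **(α-p)+(α-ff) ⟹ EACH MEMBER OF THE FORM SLOT OF RECORD IS FIBRE-TRANSPOSE-ODD AS A WHOLE KERNEL**: `trF (T κ u) = −T κ u` (the family is
field–field-supported — `StepReflectionRec.e3OfK_inl_inr ∕ _inr_inl ∕ _inr_inr` — so `sgnK` is the identity on it). -/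
theorem trF_formSlot_an1TablesS2 (hLc : Odd Lc) (N : ℕ) (cΛ cB : ℝ) (j : ℕ) (κ : Fin 4) (u : Site 4) :
    trF (e3OfK Lc (GcombSh (d := 3) Lc j) (JsB12CombSh0 hLc N (symTablesAn1S2 3 Lc cΛ) cΛ cB j).S κ u)
      = -e3OfK Lc (GcombSh (d := 3) Lc j) (JsB12CombSh0 hLc N (symTablesAn1S2 3 Lc cΛ) cΛ cB j).S κ u := by
  have h := trK_formSlot_an1TablesS2 hLc N cΛ cB j κ u
  funext x z a b
  have hx := congrFun (congrFun (congrFun (congrFun h x) z) a) b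
  rw [trK_apply] at hx
  rw [show trF (e3OfK Lc (GcombSh (d := 3) Lc j) (JsB12CombSh0 hLc N (symTablesAn1S2 3 Lc cΛ) cΛ cB j).S κ u) x z a b
      = e3OfK Lc (GcombSh (d := 3) Lc j) (JsB12CombSh0 hLc N (symTablesAn1S2 3 Lc cΛ) cΛ cB j).S κ u z x b a from rfl, hx]
  simp only [Pi.neg_apply, sgnK]
  rcases a with α | α <;> rcases b with β | β
  · rw [sgnF_inl, sgnF_inl, one_mul, one_mul]
  · rw [e3OfK_inl_inr, mul_zero, neg_zero]
  · rw [e3OfK_inr_inl, mul_zero, neg_zero]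
  · rw [e3OfK_inr_inr, mul_zero, neg_zero]

omit [∀ μ, NeZero (F μ)] in
/-- [folklore] **(α-per-p) EACH PERIODISED MEMBER OF THE FORM SLOT OF RECORD IS AN ANTISYMMETRIC MATRIX** (any period box `F`;
`PeriodisedIndexLawSummable.perF_dper_transpose_of_trF`). -/
theorem perF_dper_formSlot_an1TablesS2_transpose (hLc : Odd Lc) (N : ℕ) (cΛ cB : ℝ) (j : ℕ) (κ : Fin 4) (u : Site 4) :
    (perF F (dper F (e3OfK Lc (GcombSh (d := 3) Lc j) (JsB12CombSh0 hLc N (symTablesAn1S2 3 Lc cΛ) cΛ cB j).S κ u)))ᵀ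
      = -perF F (dper F (e3OfK Lc (GcombSh (d := 3) Lc j) (JsB12CombSh0 hLc N (symTablesAn1S2 3 Lc cΛ) cΛ cB j).S κ u)) :=
  perF_dper_transpose_of_trF (M := F) _ (trF_formSlot_an1TablesS2 hLc N cΛ cB j κ u)

omit [∀ μ, NeZero (F μ)] in
/-- [folklore] **`torus_formSlot_family_transpose` — THE (β) DOOR's ROW `hH₁t`, FORM HALF, AT LEVEL `j+1`, PER MEMBER, ANY WEIGHT** `w`, any period box `F`:
`(Φ b)ᵀ = −Φ b` at `Φ b := w • (perF F (dper F (T_{j+1} b.2 ↑b.1)))∘(fields, fields)` (with `CombLamSectorPeriodised.torus_Lam_family_transpose` for the Λ half,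
leaf-02's INTENT 19 `hH₁t` closes BY TERM). -/
theorem torus_formSlot_family_transpose (hLc : Odd Lc) (N : ℕ) (cΛ cB : ℝ) (j : ℕ) (w : ℝ) (b : ↥(pbox F) × Fin 4) :
    (w • (perF F (dper F (e3OfK Lc (GcombSh (d := 3) Lc j) (JsB12CombSh0 hLc N (symTablesAn1S2 3 Lc cΛ) cΛ cB j).S b.2 (b.1 : Site 4)))).submatrix
        (fun b : ↥(pbox F) × Fin 4 => ((b.1, Sum.inl b.2) : Idx F (Fib 3)))
        (fun b : ↥(pbox F) × Fin 4 => ((b.1, Sum.inl b.2) : Idx F (Fib 3))))ᵀ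
      = -(w • (perF F (dper F (e3OfK Lc (GcombSh (d := 3) Lc j) (JsB12CombSh0 hLc N (symTablesAn1S2 3 Lc cΛ) cΛ cB j).S b.2 (b.1 : Site 4)))).submatrix
        (fun b : ↥(pbox F) × Fin 4 => ((b.1, Sum.inl b.2) : Idx F (Fib 3)))
        (fun b : ↥(pbox F) × Fin 4 => ((b.1, Sum.inl b.2) : Idx F (Fib 3)))) := by
  rw [Matrix.transpose_smul, Matrix.transpose_submatrix, perF_dper_formSlot_an1TablesS2_transpose, ← smul_neg]
  rfl

end Summit.QuantumFields.BalabanUV.Beta.CombFormSlotPeriodised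

end
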